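import Mathlib
import Literature.Barriers.ValiantsHypothesis.AlgebraicNaturalProofs
import Summits.ValiantsHypothesis.ValiantsHypothesis.Theorems.BarrierLeverSuccinctHittingSetsForVPLowDegree
import Summits.ValiantsHypothesis.ValiantsHypothesis.Theorems.BarrierLeverSuccinctHittingSetsForVPLowSupport
import Summits.ValiantsHypothesis.ValiantsHypothesis.Theorems.BarrierLeverSuccinctHittingSetsForVPDimensionCount
import HarnessLib

/-!
# Crux `BarrierLever.SuccinctHittingSetsForVP` (stmt-ValiantsHypothesis-14610), line `registered` —
DISTINGUISHERS WITH FEW ESSENTIAL VARIABLES ARE HIT (registered stub `stub_fewLinearForms`)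

**What is proved (unconditional; structure of the open heart, it does NOT close the item).**
Sharpening the companion files `…LowDegree.lean` (low total degree) and `…LowSupport.lean` (one
monomial of small support): in FSV's framework over `ℂ` (tree regime `d = n`, coefficient variables
indexed by `degLEMonomials n`, simple class `SmallCircuits ℂ n b = {f : deg f ≤ n, L(f) ≤ n^b}`),
a distinguisher `D` with at most `t` ESSENTIAL VARIABLES — a polynomial `D = G(ℓ_1, …, ℓ_t)` in `t`
affine forms `ℓ_j` (total degree `≤ 1`) of the coefficient variables, of ANY degree and ANY size —
is hit by the coefficient vectors of `SmallCircuits ℂ n b` as soon as `t (2n + 2) ≤ n ^ b`: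

* `FewLinearForms.eq_zero_or_eq_single_of_degree_le_one` : an exponent vector of degree `≤ 1` is
  `0` or some `single μ 1`;
* `FewLinearForms.eval_eq_of_totalDegree_le_one` : the affine expansion
  `ℓ(c) = coeff_0 ℓ + Σ_μ coeff_{x_μ} ℓ · c_μ` of a polynomial of total degree `≤ 1`;
* `FewLinearForms.exists_sparse_map_eq` (linear algebra) : for a linear map `Λ` from `ℂ^ι`
  (`ι` finite) to a space of dimension `r`, every value `Λ c₀` is attained at a vector `c₁`
  supported on `≤ r` coordinates (the columns `Λ e_μ` are spanned by `≤ r` linearly independent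
  ones, Mathlib's `exists_linearIndependent'`);
* `stub_fewLinearForms` (registered stub) : if `t (2n + 2) ≤ n ^ b`, `SmallCircuits ℂ n b` is a
  succinct hitting set for `{D | D = aeval ℓ G, deg ℓ_j ≤ 1 (j < t)}`.

Proof of the stub: a nonzero `D = G(ℓ)` has a non-root `c₀` (`MvPolynomial.funext`, `ℂ`
infinite); by the affine expansion, `ℓ_j(c)` only depends on `c` through the linear map
`Λ c = (Σ_μ coeff_{x_μ} ℓ_j · c_μ)_j : ℂ^N → ℂ^t`, so a vector `c₁` supported on a set `S` of
`≤ t` coordinates with `Λ c₁ = Λ c₀` has `ℓ(c₁) = ℓ(c₀)` and `D(c₁) = G(ℓ(c₁)) = G(ℓ(c₀)) =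
D(c₀) ≠ 0` (`LowDegreeEquations.eval_comp_aeval`); finally `c₁` is the coefficient vector of the
`|S|`-sparse polynomial `Σ_{μ ∈ S} c₁(μ) x^μ` of degree `≤ n` and size `≤ |S| (2n + 2) ≤ n ^ b`
(`LowDegree.coeffVector_sparse`, `LowDegree.sparse_mem_smallCircuits`). The case `t = 0` (constant
`D`, hit by `f = 0`) is the case `S = ∅`. Axioms: `propext`, `Classical.choice`, `Quot.sound`.
References: [ForbesShpilkaVolk2018] Def. 1, Def. 3, Question 6 (framework); the reduction to the
essential variables (Carlini 2006) is folklore linear algebra.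
-/

-- layout Summits/ValiantsHypothesis/ValiantsHypothesis forces the duplicated namespace component
set_option linter.dupNamespace false

namespace Summit.ValiantsHypothesis.ValiantsHypothesis.Theorems.BarrierLever.SuccinctHittingSetsForVP

open Literature.Barriers.ValiantsHypothesis Literature.Computability.AlgebraicComplexity MvPolynomial

namespace FewLinearForms

variable {ι : Type*}

/-- An exponent vector of degree `≤ 1` is either `0` or a single variable `single μ 1`.
[folklore] -/
theorem eq_zero_or_eq_single_of_degree_le_one {d : ι →₀ ℕ} (hd : d.degree ≤ 1) :
    d = 0 ∨ ∃ μ, d = Finsupp.single μ 1 := by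
  rcases Nat.lt_or_ge d.degree 1 with h | h
  · exact Or.inl ((Finsupp.degree_eq_zero_iff d).mp (by omega))
  · have h1 : d ∈ {d : ι →₀ ℕ | d.degree = 1} := le_antisymm hd h
    rw [← Finsupp.range_single_one] at h1
    obtain ⟨μ, hμ⟩ := h1
    exact Or.inr ⟨μ, hμ.symm⟩

/-- **Affine expansion.** A polynomial `p` of total degree `≤ 1` over `ℂ` in finitely many
variables is the affine form `p(c) = coeff_0 p + Σ_μ coeff_{x_μ} p · c_μ`. [folklore] -/
theorem eval_eq_of_totalDegree_le_one [Fintype ι] {p : MvPolynomial ι ℂ} (hp : p.totalDegree ≤ 1)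
    (c : ι → ℂ) : eval c p = coeff 0 p + ∑ μ, coeff (Finsupp.single μ 1) p * c μ := by
  classical
  -- the expansion for the monomials of `p`, which have degree `≤ 1`
  have key : ∀ d ∈ p.support, ∀ a : ℂ, eval c (monomial d a) =
      coeff 0 (monomial d a) + ∑ μ, coeff (Finsupp.single μ 1) (monomial d a) * c μ := by
    intro d hd a
    have hdeg : d.degree ≤ 1 := (le_totalDegree hd).trans hp
    rcases eq_zero_or_eq_single_of_degree_le_one hdeg with rfl | ⟨ν, rfl⟩
    · have h1 : ∀ μ : ι, coeff (Finsupp.single μ 1) (monomial (0 : ι →₀ ℕ) a) = 0 := fun μ => by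
        rw [coeff_monomial, if_neg fun h0 => Finsupp.single_ne_zero.mpr one_ne_zero h0.symm]
      simp only [h1, zero_mul, Finset.sum_const_zero, add_zero, coeff_monomial, ite_true,
        eval_monomial, Finsupp.prod_zero_index, mul_one]
    · have h1 : ∀ μ : ι, coeff (Finsupp.single μ 1) (monomial (Finsupp.single ν 1) a) =
          if ν = μ then a else 0 := fun μ => by
        rw [coeff_monomial]
        simp only [Finsupp.single_left_inj one_ne_zero]
      have h0 : coeff 0 (monomial (Finsupp.single ν 1) a) = 0 := by
        rw [coeff_monomial, if_neg (Finsupp.single_ne_zero.mpr one_ne_zero)]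
      simp only [h1, h0, zero_add, ite_mul, zero_mul, Finset.sum_ite_eq, Finset.mem_univ,
        ite_true, eval_monomial]
      rw [Finsupp.prod_single_index, pow_one]
      exact pow_zero _
  -- sum the expansion over the monomials of `p`
  have hsum : ∀ m : ι →₀ ℕ, ∑ d ∈ p.support, coeff m (monomial d (coeff d p)) = coeff m p := by
    intro m
    have h := congr_arg (coeff m) p.as_sum
    rw [coeff_sum] at h
    exact h.symm
  have hev : eval c p = ∑ d ∈ p.support, eval c (monomial d (coeff d p)) := by
    have h := congr_arg (eval c) p.as_sum
    rwa [map_sum] at h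
  calc eval c p = ∑ d ∈ p.support, eval c (monomial d (coeff d p)) := hev
    _ = ∑ d ∈ p.support, (coeff 0 (monomial d (coeff d p)) +
          ∑ μ, coeff (Finsupp.single μ 1) (monomial d (coeff d p)) * c μ) :=
        Finset.sum_congr rfl fun d hd => key d hd _
    _ = coeff 0 p + ∑ μ, coeff (Finsupp.single μ 1) p * c μ := by
        rw [Finset.sum_add_distrib, Finset.sum_comm, hsum 0]
        congr 1
        refine Finset.sum_congr rfl fun μ _ => ?_
        rw [← Finset.sum_mul, hsum]

/-- **Sparse preimages (linear algebra).** For a `ℂ`-linear map `Λ` on `ℂ^ι` (`ι` finite) with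
values in a space of dimension `r`, every value `Λ c₀` is attained at a vector `c₁` supported on at
most `r` coordinates: among the columns `Λ e_μ` choose linearly independent ones with the same
span (`≤ r` of them) and expand `Λ c₀` in them. [folklore] -/
theorem exists_sparse_map_eq [Fintype ι] {W : Type*} [AddCommGroup W] [Module ℂ W]
    [FiniteDimensional ℂ W] (Λ : (ι → ℂ) →ₗ[ℂ] W) (c₀ : ι → ℂ) :
    ∃ (S : Finset ι) (c₁ : ι → ℂ), S.card ≤ Module.finrank ℂ W ∧ (∀ μ, μ ∉ S → c₁ μ = 0) ∧
      Λ c₁ = Λ c₀ := by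
  classical
  obtain ⟨κ, a, -, hspan, hli⟩ := exists_linearIndependent' ℂ (fun μ : ι => Λ (Pi.single μ 1))
  haveI : Finite κ := hli.finite
  haveI : Fintype κ := Fintype.ofFinite κ
  have hsingle : ∀ (μ : ι) (x : ℂ), Λ (Pi.single μ x) = x • Λ (Pi.single μ 1) := fun μ x => by
    rw [← map_smul, ← Pi.single_smul', smul_eq_mul, mul_one]
  have hmem : Λ c₀ ∈ Submodule.span ℂ (Set.range ((fun μ : ι => Λ (Pi.single μ 1)) ∘ a)) := by
    rw [hspan, Submodule.mem_span_range_iff_exists_fun]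
    refine ⟨c₀, ?_⟩
    calc ∑ μ, c₀ μ • Λ (Pi.single μ 1) = Λ (∑ μ, Pi.single μ (c₀ μ)) := by
          rw [map_sum]
          exact Finset.sum_congr rfl fun μ _ => (hsingle μ (c₀ μ)).symm
      _ = Λ c₀ := by rw [Finset.univ_sum_single]
  obtain ⟨g, hg⟩ := (Submodule.mem_span_range_iff_exists_fun ℂ).mp hmem
  refine ⟨Finset.univ.image a, ∑ k, Pi.single (a k) (g k), ?_, ?_, ?_⟩
  · calc (Finset.univ.image a).card ≤ Finset.univ.card := Finset.card_image_le
      _ = Fintype.card κ := Finset.card_univ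
      _ ≤ Module.finrank ℂ W := hli.fintype_card_le_finrank
  · intro μ hμ
    rw [Finset.sum_apply]
    refine Finset.sum_eq_zero fun k _ => ?_
    have hk : a k ≠ μ := fun h => hμ (Finset.mem_image.mpr ⟨k, Finset.mem_univ _, h⟩)
    exact Pi.single_eq_of_ne' hk _
  · rw [map_sum, ← hg]
    exact Finset.sum_congr rfl fun k _ => by rw [Function.comp_apply, hsingle]

end FewLinearForms

open FewLinearForms

/-- **Registered stub `stub_fewLinearForms`** (crux stmt-ValiantsHypothesis-14610, line
`registered`; distinguishers with few ESSENTIAL VARIABLES are hit, whatever their degree and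
size): if `t (2n + 2) ≤ n ^ b`, the coefficient vectors of `SmallCircuits ℂ n b` hit every
nonzero `D` that is a polynomial `G(ℓ_1, …, ℓ_t)` in `t` affine forms `ℓ_j` (total degree `≤ 1`)
of the coefficient variables (Carlini 2006: `D` has `≤ t` essential variables). A non-root `c₀` of
`D` is matched on `ℓ` by a vector `c₁` supported on `≤ t` coordinates `S` (the columns of the
linear part of `ℓ` are spanned by `≤ t` of them), so `D(c₁) = G(ℓ(c₁)) = G(ℓ(c₀)) ≠ 0`, and `c₁` is
the coefficient vector of `Σ_{μ ∈ S} c₁(μ) x^μ ∈ SmallCircuits ℂ n b`.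
[cite: ForbesShpilkaVolk2018, Def. 3 and Question 6] -/
theorem stub_fewLinearForms :
    ∀ n t b : ℕ, t * (2 * n + 2) ≤ n ^ b →
      IsSuccinctHittingSet (degLEMonomials n) (SmallCircuits ℂ n b)
        {D | ∃ (ℓ : Fin t → MvPolynomial (degLEMonomials n) ℂ) (G : MvPolynomial (Fin t) ℂ),
          (∀ j, (ℓ j).totalDegree ≤ 1) ∧ D = MvPolynomial.aeval ℓ G} := by
  intro n t b h
  classical
  rintro D ⟨ℓ, G, hℓ, rfl⟩ hD0
  haveI : Fintype (degLEMonomials n) := (Finsupp.finite_of_degree_le (σ := Fin n) n).fintype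
  -- a non-root of `D = G(ℓ)` (`ℂ` is infinite)
  obtain ⟨c₀, hc₀⟩ : ∃ c₀ : degLEMonomials n → ℂ, eval c₀ (aeval ℓ G) ≠ 0 := by
    by_contra hcon
    push Not at hcon
    exact hD0 (MvPolynomial.funext fun v => by simpa using hcon v)
  -- match it on the linear part of `ℓ` by a vector supported on `≤ t` coordinates
  obtain ⟨S, c₁, hS, hc₁, hΛ⟩ := exists_sparse_map_eq
    (Matrix.mulVecLin (Matrix.of fun (j : Fin t) (μ : degLEMonomials n) =>
      coeff (Finsupp.single μ 1) (ℓ j))) c₀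
  have ht : S.card ≤ t := hS.trans_eq (Module.finrank_fin_fun ℂ)
  have hev : ∀ j, eval c₁ (ℓ j) = eval c₀ (ℓ j) := fun j => by
    have hj := congr_fun hΛ j
    simp only [Matrix.mulVecLin_apply, Matrix.mulVec, dotProduct, Matrix.of_apply] at hj
    rw [eval_eq_of_totalDegree_le_one (hℓ j) c₁, eval_eq_of_totalDegree_le_one (hℓ j) c₀, hj]
  -- `c₁` is the coefficient vector of an `|S|`-sparse small circuit
  refine ⟨∑ μ ∈ S, monomial (μ : Fin n →₀ ℕ) (c₁ μ), LowDegree.sparse_mem_smallCircuits S c₁ ?_, ?_⟩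
  · exact le_trans (Nat.mul_le_mul_right _ ht) h
  · rw [LowDegree.coeffVector_sparse S hc₁, LowDegreeEquations.eval_comp_aeval,
      show (fun j => eval c₁ (ℓ j)) = fun j => eval c₀ (ℓ j) from funext hev,
      ← LowDegreeEquations.eval_comp_aeval]
    exact hc₀

end Summit.ValiantsHypothesis.ValiantsHypothesis.Theorems.BarrierLever.SuccinctHittingSetsForVP
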